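import Mathlib.Analysis.Calculus.Taylor
import Mathlib.Analysis.Calculus.IteratedDeriv.Lemmas
import Mathlib.Analysis.SpecialFunctions.Trigonometric.Sinc
import Mathlib.Analysis.SpecialFunctions.Complex.Circle
import HarnessLib

/-!
# The value of the archimedean central-limit functional from the wall germs (compact wall)

Rogawski, *Automorphic representations of unitary groups in three variables* (1990), §8.4 pp. 126–127:
the constant of Harish-Chandra's limit formula at the centre of `U(2,1)`, computed through the compact
wall `{z₀ = z₁}`.  Along the wall curve `k_t = ζ·e^{itA⃗}` (`A⃗ = (1,1,−2)`, `w = (k_t)₂/(k_t)₀ = e^{−3it}`)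
★ `ArchCentralLimitCompactWallLeibniz` reads the wall jets of `F = ρ′Δ·Φ` as
`NF(k_t) = D′(0)·Φ(k_t)`, `N³F(k_t) = D‴(0)·Φ(k_t) + 3D′(0)·N²Φ(k_t)` with (§1 here)
`D′(0) = −2i·m(t)`, `D‴(0) = 12i + 2i·m(t)`, **`m(t) := 2 − 2cos 3t = |1 − w|²`**; and ★
`ArchCentralLimitCompactWallCornerTransfer` shows that for a `C³` chamber extension `H` at the corner
(compact-adjacent chamber) `Λ₈^∠[H](0) = ¼·(L₁ − L₂)` with
`L₁ = lim_{t→0⁺} (d/dt)² NF(k_t)` and `L₂ = lim_{t→0⁺} N³F(k_t)`.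

In the normalisation `ψ := m·Φ(k_·)`, `χ := m²·N²Φ(k_·)` (the natural `|1 − w|²`-weights; `Φ ~ m⁻¹`,
`N²Φ ~ m⁻²` at the corner) this reads `NF(k_t) = −2i·ψ(t)` and
`N³F(k_t) = 2i·ψ(t) + (12i·ψ(t) − 6i·χ(t))/m(t)`, and this file proves the pure one-variable statement:
IF `ψ, χ` are `C²` on `[0, δ]` and the two limits `L₁, L₂` exist, THEN
  `¼·(L₁ − L₂) = −(2/3)i·ψ″(0⁺) − (1/2)i·ψ(0) + (1/12)i·χ″(0⁺)`
(`ψ″(0⁺) = iteratedDerivWithin 2 ψ (Icc 0 δ) 0`), the existence of `L₂` forcing `12ψ(0) = 6χ(0)` and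
`12ψ′(0⁺) = 6χ′(0⁺)` (Taylor to order two, Mathlib `taylor_isLittleO`, and `m(t)/t² → 9`).
Sanity (`U(3)`, everything smooth at the centre): `ψ = m·Φ`, `χ = m²·N²Φ` give `ψ(0) = 0`, `ψ″(0) = 18Φ(ζ·1)`,
`χ″(0) = 0`, value `−12i·Φ(ζ·1)` = ★ `ArchCentralLimitFunctional`'s `−12i·μ(K)`.

Contents: §1 the normaliser `m` and the dictionary with ★ Leibniz's coefficients at `k_t`; §2 one-sided
second derivatives as limits; §3 order-two Taylor bookkeeping and the quotient limit `n/m → n″(0⁺)/18`;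
§4 the value.
-/

namespace Literature.NumberTheory.Rogawski1990

open Filter Topology Set Asymptotics Complex

/-! ## §1 The normaliser `m(t) = 2 − 2cos 3t` -/

section Normaliser

/-- `2 − 2cos 3t = 4 sin²(3t/2)`. [cite: Rogawski1990, §8.4 p. 126] -/
theorem wallNormaliser_eq_four_mul_sin_sq (t : ℝ) : 2 - 2 * Real.cos (3 * t) = 4 * Real.sin (3 * t / 2) ^ 2 := by
  have h : 3 * t = 2 * (3 * t / 2) := by ring
  rw [h, Real.cos_two_mul, Real.cos_sq']
  ring

/-- **`m(t)/t² → 9`** as `t → 0`, `t ≠ 0` (`m/t² = 9·sinc²(3t/2)`, Mathlib `Real.continuous_sinc`). [cite: Rogawski1990, §8.4 p. 126] -/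
theorem tendsto_wallNormaliser_div_sq : Tendsto (fun t : ℝ => (2 - 2 * Real.cos (3 * t)) / t ^ 2) (𝓝[≠] 0) (𝓝 9) := by
  have key : ∀ t : ℝ, t ≠ 0 → (2 - 2 * Real.cos (3 * t)) / t ^ 2 = 9 * Real.sinc (3 * t / 2) ^ 2 := by
    intro t ht
    have h32 : 3 * t / 2 ≠ 0 := by positivity
    rw [wallNormaliser_eq_four_mul_sin_sq, Real.sinc_of_ne_zero h32]
    field_simp
    ring
  have hc : Tendsto (fun t : ℝ => 9 * Real.sinc (3 * t / 2) ^ 2) (𝓝 0) (𝓝 (9 * Real.sinc (3 * 0 / 2) ^ 2)) :=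
    ((Real.continuous_sinc.comp (by fun_prop : Continuous fun t : ℝ => 3 * t / 2)).pow 2 |>.const_mul 9).tendsto 0
  rw [mul_zero, zero_div, Real.sinc_zero, one_pow, mul_one] at hc
  refine (hc.mono_left nhdsWithin_le_nhds).congr' ?_
  filter_upwards [self_mem_nhdsWithin] with t ht
  exact (key t ht).symm

/-- `m` is continuous with `m(0) = 0`: `m(t) → 0` as `t → 0`. [cite: Rogawski1990, §8.4 p. 126] -/
theorem tendsto_wallNormaliser_zero : Tendsto (fun t : ℝ => 2 - 2 * Real.cos (3 * t)) (𝓝 0) (𝓝 0) := by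
  have hc : Continuous fun t : ℝ => 2 - 2 * Real.cos (3 * t) := by fun_prop
  simpa using hc.tendsto 0

/-- **Dictionary with ★ `ArchCentralLimitCompactWallLeibniz` at `k_t = ζ·e^{itA⃗}`**: the base-point ratios are `(k_t)₀/(k_t)₂ = e^{3it}`,
`(k_t)₂/(k_t)₀ = e^{−3it}`. [cite: Rogawski1990, §8.4 p. 126] -/
theorem wallPoint_ratio (ζ : Circle) (t : ℝ) :
    (((fun j : Fin 3 => ζ * Circle.exp ((t • (![1, 1, -2] : Fin 3 → ℝ)) j)) 0 : Circle) : ℂ) *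
        ((((fun j : Fin 3 => ζ * Circle.exp ((t • (![1, 1, -2] : Fin 3 → ℝ)) j)) 2 : Circle) : ℂ))⁻¹ = Complex.exp (3 * t * I) ∧
      (((fun j : Fin 3 => ζ * Circle.exp ((t • (![1, 1, -2] : Fin 3 → ℝ)) j)) 2 : Circle) : ℂ) *
        ((((fun j : Fin 3 => ζ * Circle.exp ((t • (![1, 1, -2] : Fin 3 → ℝ)) j)) 0 : Circle) : ℂ))⁻¹ = Complex.exp (-(3 * t) * I) := by
  have hζ : (ζ : ℂ) ≠ 0 := Circle.coe_ne_zero ζ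
  constructor
  · simp only [Pi.smul_apply, smul_eq_mul, Matrix.cons_val_zero, Matrix.cons_val_two, Matrix.tail_cons, Matrix.head_cons,
      Circle.coe_mul, Circle.coe_exp]
    rw [mul_inv, ← Complex.exp_neg]
    field_simp
    rw [← Complex.exp_add]
    push_cast
    ring_nf
  · simp only [Pi.smul_apply, smul_eq_mul, Matrix.cons_val_zero, Matrix.cons_val_two, Matrix.tail_cons, Matrix.head_cons,
      Circle.coe_mul, Circle.coe_exp]
    rw [mul_inv, ← Complex.exp_neg]
    field_simp
    rw [← Complex.exp_add]
    push_cast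
    ring_nf

/-- **`D′(0)(t) = −2i·m(t)`**: ★ Leibniz's first-jet coefficient `2i·(k₀/k₂)·(1 − k₂/k₀)²` at `k_t`, as a function of the wall parameter.
[cite: Rogawski1990, §8.4 p. 126] -/
theorem firstJetCoeff_eq_wallNormaliser (t : ℝ) :
    2 * I * Complex.exp (3 * t * I) * (1 - Complex.exp (-(3 * t) * I)) ^ 2 = -2 * I * ((2 - 2 * Real.cos (3 * t) : ℝ) : ℂ) := by
  have hE : Complex.exp (3 * t * I) ≠ 0 := Complex.exp_ne_zero _
  have hneg : Complex.exp (-(3 * t) * I) = (Complex.exp (3 * t * I))⁻¹ := by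
    rw [← Complex.exp_neg]; ring_nf
  have hcos : Complex.cos (3 * (t : ℂ)) = (Complex.exp (3 * t * I) + (Complex.exp (3 * t * I))⁻¹) / 2 := by
    rw [Complex.cos, ← Complex.exp_neg]
    ring_nf
  push_cast
  rw [hcos, hneg]
  field_simp
  ring

/-- **`D‴(0)(t) = 12i + 2i·m(t)`**: ★ Leibniz's third-jet coefficient `2i·(k₀/k₂)·(8w − 1 − w²)`, `w = k₂/k₀`, at `k_t`.
[cite: Rogawski1990, §8.4 p. 126] -/
theorem thirdJetCoeff_eq_wallNormaliser (t : ℝ) :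
    2 * I * Complex.exp (3 * t * I) * (8 * Complex.exp (-(3 * t) * I) - 1 - Complex.exp (-(3 * t) * I) ^ 2) =
      12 * I + 2 * I * ((2 - 2 * Real.cos (3 * t) : ℝ) : ℂ) := by
  have hE : Complex.exp (3 * t * I) ≠ 0 := Complex.exp_ne_zero _
  have hneg : Complex.exp (-(3 * t) * I) = (Complex.exp (3 * t * I))⁻¹ := by
    rw [← Complex.exp_neg]; ring_nf
  have hcos : Complex.cos (3 * (t : ℂ)) = (Complex.exp (3 * t * I) + (Complex.exp (3 * t * I))⁻¹) / 2 := by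
    rw [Complex.cos, ← Complex.exp_neg]
    ring_nf
  push_cast
  rw [hcos, hneg]
  field_simp
  ring

end Normaliser

/-! ## §2 One-sided second derivatives as limits from the right -/

section OneSided

/-- Inside the interval the within-derivative is the derivative. [cite: Rogawski1990, §8.4 p. 126] -/
theorem iteratedDerivWithin_eq_iteratedDeriv_of_mem_nhds {f : ℝ → ℂ} {s : Set ℝ} {x : ℝ} (h : s ∈ 𝓝 x) (n : ℕ) :
    iteratedDerivWithin n f s x = iteratedDeriv n f x := by
  rw [iteratedDerivWithin_eq_iteratedFDerivWithin, iteratedDeriv_eq_iteratedFDeriv, ← iteratedFDerivWithin_univ,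
    iteratedFDerivWithin_congr_set (eventuallyEq_univ.2 h)]

/-- `𝓝[>] 0 ≤ 𝓝[Icc 0 δ] 0`. [cite: Rogawski1990, §8.4 p. 126] -/
theorem nhdsGT_le_nhdsWithin_Icc {δ : ℝ} (hδ : 0 < δ) : 𝓝[>] (0 : ℝ) ≤ 𝓝[Icc 0 δ] 0 := by
  rw [← nhdsWithin_Ioo_eq_nhdsGT hδ]
  exact nhdsWithin_mono _ Ioo_subset_Icc_self

/-- **The second derivative from the right**: for `ψ` of class `C²` on `[0, δ]`, `ψ″(t) → ψ″(0⁺) := iteratedDerivWithin 2 ψ (Icc 0 δ) 0` as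
`t → 0⁺`. [cite: Rogawski1990, §8.4 p. 126] -/
theorem tendsto_iteratedDeriv_two_nhdsGT {ψ : ℝ → ℂ} {δ : ℝ} (hδ : 0 < δ) (hψ : ContDiffOn ℝ 2 ψ (Icc 0 δ)) :
    Tendsto (fun t : ℝ => iteratedDeriv 2 ψ t) (𝓝[>] 0) (𝓝 (iteratedDerivWithin 2 ψ (Icc 0 δ) 0)) := by
  have hc : ContinuousWithinAt (iteratedDerivWithin 2 ψ (Icc 0 δ)) (Icc 0 δ) 0 :=
    (hψ.continuousOn_iteratedDerivWithin le_rfl (uniqueDiffOn_Icc hδ)) 0 (left_mem_Icc.2 hδ.le)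
  refine (hc.tendsto.mono_left (nhdsGT_le_nhdsWithin_Icc hδ)).congr' ?_
  rw [← nhdsWithin_Ioo_eq_nhdsGT hδ]
  filter_upwards [self_mem_nhdsWithin] with t ht
  exact iteratedDerivWithin_eq_iteratedDeriv_of_mem_nhds (Icc_mem_nhds ht.1 ht.2) 2

end OneSided

/-! ## §3 Order-two Taylor bookkeeping and the quotient limit -/

section Quotient

/-- Order-two Taylor expansion at `0⁺` in coefficient form (Mathlib `taylor_isLittleO`). [cite: Rogawski1990, §8.4 p. 126] -/
theorem taylor_two_isLittleO_nhdsGT {n : ℝ → ℂ} {δ : ℝ} (hδ : 0 < δ) (hn : ContDiffOn ℝ 2 n (Icc 0 δ)) :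
    (fun x : ℝ => n x - (n 0 + (x : ℂ) * derivWithin n (Icc 0 δ) 0 + ((x ^ 2 / 2 : ℝ) : ℂ) * iteratedDerivWithin 2 n (Icc 0 δ) 0))
      =o[𝓝[>] (0 : ℝ)] fun x : ℝ => x ^ 2 := by
  have h := (taylor_isLittleO (convex_Icc 0 δ) (left_mem_Icc.2 hδ.le) hn).mono (nhdsGT_le_nhdsWithin_Icc hδ)
  refine (h.congr' ?_ ?_)
  · filter_upwards with x
    rw [taylor_within_apply]
    simp only [Finset.sum_range_succ, Finset.sum_range_zero, zero_add, Nat.factorial, sub_zero, pow_zero, pow_one,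
      iteratedDerivWithin_zero, iteratedDerivWithin_one, Complex.real_smul]
    push_cast
    ring
  · filter_upwards with x
    rw [sub_zero]

/-- **THE QUOTIENT LIMIT.**  If `n` is `C²` on `[0, δ]` and `n(t)/m(t) → L` as `t → 0⁺` (`m(t) = 2 − 2cos 3t ~ 9t²`), then `n(0) = 0`,
`n′(0⁺) = 0` and `L = n″(0⁺)/18`. [cite: Rogawski1990, §8.4 pp. 126–127] -/
theorem eq_of_tendsto_div_wallNormaliser {n : ℝ → ℂ} {δ : ℝ} (hδ : 0 < δ) (hn : ContDiffOn ℝ 2 n (Icc 0 δ)) {L : ℂ}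
    (hL : Tendsto (fun t : ℝ => n t / ((2 - 2 * Real.cos (3 * t) : ℝ) : ℂ)) (𝓝[>] 0) (𝓝 L)) :
    n 0 = 0 ∧ derivWithin n (Icc 0 δ) 0 = 0 ∧ L = iteratedDerivWithin 2 n (Icc 0 δ) 0 / 18 := by
  set n0 : ℂ := n 0 with hn0
  set n1 : ℂ := derivWithin n (Icc 0 δ) 0 with hn1
  set n2 : ℂ := iteratedDerivWithin 2 n (Icc 0 δ) 0 with hn2
  have hle : 𝓝[>] (0 : ℝ) ≤ 𝓝[≠] 0 := nhdsWithin_mono _ fun x hx => ne_of_gt hx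
  -- the normaliser: `m/t² → 9`, `m → 0`, `m/t → 0`, `m ≠ 0` eventually (real and complex forms)
  have hm2 : Tendsto (fun t : ℝ => (2 - 2 * Real.cos (3 * t)) / t ^ 2) (𝓝[>] 0) (𝓝 9) := tendsto_wallNormaliser_div_sq.mono_left hle
  have hm0 : Tendsto (fun t : ℝ => 2 - 2 * Real.cos (3 * t)) (𝓝[>] 0) (𝓝 0) := tendsto_wallNormaliser_zero.mono_left nhdsWithin_le_nhds
  have hid : Tendsto (fun t : ℝ => t) (𝓝[>] (0 : ℝ)) (𝓝 0) := tendsto_id.mono_left nhdsWithin_le_nhds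
  have hm1 : Tendsto (fun t : ℝ => (2 - 2 * Real.cos (3 * t)) / t) (𝓝[>] 0) (𝓝 0) := by
    have h := hm2.mul hid
    rw [mul_zero] at h
    refine h.congr' ?_
    filter_upwards [self_mem_nhdsWithin] with t ht
    have ht' : t ≠ 0 := ne_of_gt ht
    rw [div_mul_eq_mul_div, pow_two, mul_div_mul_right _ _ ht']
  have hmne : ∀ᶠ t : ℝ in 𝓝[>] 0, 2 - 2 * Real.cos (3 * t) ≠ 0 := by
    filter_upwards [hm2.eventually (lt_mem_nhds (by norm_num : (0 : ℝ) < 9)), self_mem_nhdsWithin] with t ht ht0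
    intro h
    rw [h, zero_div] at ht
    exact lt_irrefl _ ht
  -- complex casts of the normaliser limits
  have hm0c : Tendsto (fun t : ℝ => (((2 - 2 * Real.cos (3 * t) : ℝ)) : ℂ)) (𝓝[>] 0) (𝓝 0) := by
    have h := (Complex.continuous_ofReal.tendsto 0).comp hm0
    rw [Complex.ofReal_zero] at h
    exact h
  have hm1c : Tendsto (fun t : ℝ => (((2 - 2 * Real.cos (3 * t) : ℝ)) : ℂ) / (t : ℂ)) (𝓝[>] 0) (𝓝 0) := by
    have h := (Complex.continuous_ofReal.tendsto 0).comp hm1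
    simp only [Function.comp_def, Complex.ofReal_zero, Complex.ofReal_div] at h
    exact h
  have hm2c : Tendsto (fun t : ℝ => (((2 - 2 * Real.cos (3 * t) : ℝ)) : ℂ) / (t : ℂ) ^ 2) (𝓝[>] 0) (𝓝 9) := by
    have h := (Complex.continuous_ofReal.tendsto 9).comp hm2
    simp only [Function.comp_def, Complex.ofReal_div, Complex.ofReal_pow] at h
    exact_mod_cast h
  -- Taylor: `r := n − (n0 + n1 t + n2 t²/2) = o(t²)`, so `r/t² → 0` and `r/t → 0`
  have hT := (taylor_two_isLittleO_nhdsGT hδ hn).trans_isBigO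
    (Asymptotics.IsBigO.of_bound (1 : ℝ) (Eventually.of_forall fun x : ℝ => by simp) :
      (fun x : ℝ => x ^ 2) =O[𝓝[>] (0 : ℝ)] fun x : ℝ => ((x : ℂ)) ^ 2)
  have hr2 : Tendsto (fun t : ℝ => (n t - (n0 + (t : ℂ) * n1 + ((t ^ 2 / 2 : ℝ) : ℂ) * n2)) / (t : ℂ) ^ 2) (𝓝[>] 0) (𝓝 0) := by
    simpa only [hn0, hn1, hn2] using hT.tendsto_div_nhds_zero
  have hr1 : Tendsto (fun t : ℝ => (n t - (n0 + (t : ℂ) * n1 + ((t ^ 2 / 2 : ℝ) : ℂ) * n2)) / (t : ℂ)) (𝓝[>] 0) (𝓝 0) := by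
    have hidc : Tendsto (fun t : ℝ => (t : ℂ)) (𝓝[>] (0 : ℝ)) (𝓝 0) := by
      have h := (Complex.continuous_ofReal.tendsto 0).comp hid
      rw [Complex.ofReal_zero] at h
      exact h
    have h := hr2.mul hidc
    rw [mul_zero] at h
    refine h.congr' ?_
    filter_upwards [self_mem_nhdsWithin] with t ht
    have ht' : (t : ℂ) ≠ 0 := by exact_mod_cast ne_of_gt ht
    field_simp
  -- Step 1: `n 0 = 0`
  have hn_cont : Tendsto n (𝓝[>] 0) (𝓝 n0) :=
    ((hn.continuousOn.continuousWithinAt (left_mem_Icc.2 hδ.le)).tendsto).mono_left (nhdsGT_le_nhdsWithin_Icc hδ)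
  have hstep1 : n0 = 0 := by
    have h := hL.mul hm0c
    rw [mul_zero] at h
    refine tendsto_nhds_unique hn_cont (h.congr' ?_)
    filter_upwards [hmne] with t ht
    have ht' : (((2 - 2 * Real.cos (3 * t) : ℝ)) : ℂ) ≠ 0 := by exact_mod_cast ht
    exact div_mul_cancel₀ (n t) ht'
  -- Step 2: `n1 = 0` (compare `n/t = (n/m)·(m/t) → 0` with Taylor `n/t → n1`)
  have hnt0 : Tendsto (fun t : ℝ => n t / (t : ℂ)) (𝓝[>] 0) (𝓝 0) := by
    have h := hL.mul hm1c
    rw [mul_zero] at h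
    refine h.congr' ?_
    filter_upwards [hmne, self_mem_nhdsWithin] with t ht ht0
    have ht' : (((2 - 2 * Real.cos (3 * t) : ℝ)) : ℂ) ≠ 0 := by exact_mod_cast ht
    rw [div_mul_div_comm, mul_comm ((((2 - 2 * Real.cos (3 * t) : ℝ)) : ℂ)) (t : ℂ), mul_div_mul_right _ _ ht']
  have hnt1 : Tendsto (fun t : ℝ => n t / (t : ℂ)) (𝓝[>] 0) (𝓝 n1) := by
    have hidc : Tendsto (fun t : ℝ => (t : ℂ)) (𝓝[>] (0 : ℝ)) (𝓝 0) := by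
      have h := (Complex.continuous_ofReal.tendsto 0).comp hid
      rw [Complex.ofReal_zero] at h
      exact h
    have h := hr1.add (tendsto_const_nhds.add ((hidc.mul tendsto_const_nhds).div_const 2) :
      Tendsto (fun t : ℝ => n1 + (t : ℂ) * n2 / 2) (𝓝[>] (0 : ℝ)) (𝓝 (n1 + 0 * n2 / 2)))
    rw [zero_mul, zero_div, add_zero, zero_add] at h
    refine h.congr' ?_
    filter_upwards [self_mem_nhdsWithin] with t ht
    have ht0' : (t : ℂ) ≠ 0 := by exact_mod_cast ne_of_gt ht
    rw [hstep1]
    push_cast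
    field_simp
    ring
  have hstep2 : n1 = 0 := tendsto_nhds_unique hnt1 hnt0
  -- Step 3: `n/t² → n2/2`, `m/t² → 9`, hence `n/m → n2/18`
  have hnt2 : Tendsto (fun t : ℝ => n t / (t : ℂ) ^ 2) (𝓝[>] 0) (𝓝 (n2 / 2)) := by
    have h := hr2.add (tendsto_const_nhds : Tendsto (fun _ : ℝ => n2 / 2) (𝓝[>] (0 : ℝ)) (𝓝 (n2 / 2)))
    rw [zero_add] at h
    refine h.congr' ?_
    filter_upwards [self_mem_nhdsWithin] with t ht
    have ht0' : (t : ℂ) ≠ 0 := by exact_mod_cast ne_of_gt ht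
    rw [hstep1, hstep2]
    push_cast
    field_simp
    ring
  have hquot : Tendsto (fun t : ℝ => n t / ((2 - 2 * Real.cos (3 * t) : ℝ) : ℂ)) (𝓝[>] 0) (𝓝 (n2 / 2 / 9)) := by
    have h := hnt2.div hm2c (by norm_num)
    refine h.congr' ?_
    filter_upwards [self_mem_nhdsWithin] with t ht0
    have ht0' : (t : ℂ) ≠ 0 := by exact_mod_cast ne_of_gt ht0
    show n t / (t : ℂ) ^ 2 / (((((2 - 2 * Real.cos (3 * t) : ℝ)) : ℂ)) / (t : ℂ) ^ 2) = _
    exact div_div_div_cancel_right₀ (pow_ne_zero 2 ht0') _ _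
  have hstep3 : L = n2 / 18 := by
    have h := tendsto_nhds_unique hL hquot
    rw [h]
    ring
  exact ⟨hstep1, hstep2, hstep3⟩

end Quotient

/-! ## §4 The value -/

section Value

/-- **THE VALUE OF THE CENTRAL-LIMIT FUNCTIONAL FROM THE WALL GERMS (compact-adjacent chambers).**
Let `ψ, χ : ℝ → ℂ` be of class `C²` on `[0, δ]` (`ψ = m·Φ(k_·)`, `χ = m²·N²Φ(k_·)`, `m = 2 − 2cos 3t`) and suppose the two limits
`L₁ = lim_{t→0⁺} (d/dt)²(−2i·ψ)(t)` (`= lim (d/dτ)²NF`) and `L₂ = lim_{t→0⁺} (2i·ψ(t) + (12i·ψ(t) − 6i·χ(t))/m(t))` (`= lim N³F`) exist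
(★ `tendsto_wall01_jets_of_cornerExtension`: they do, given a `C³` corner extension).  THEN
`¼·(L₁ − L₂) = −(2/3)i·ψ″(0⁺) − (1/2)i·ψ(0) + (1/12)i·χ″(0⁺)`, and necessarily `12ψ(0) = 6χ(0)`, `12ψ′(0⁺) = 6χ′(0⁺)`.
(In Laurent coefficients `Φ(k_t) = C/t² + C₁/t + C₀ + …`, `N²Φ(k_t) = d₋₄/t⁴ + … + d₋₂/t² + …`: the value is `−12i·C₀ + (27/2)i·d₋₂`;
at `U(3)` it is `−12i·Φ(ζ·1)`.) [cite: Rogawski1990, §8.4 pp. 126–127] [cite: Varadarajan1989, §6.4] -/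
theorem quarter_sub_eq_of_wallGerms {ψ χ : ℝ → ℂ} {δ : ℝ} (hδ : 0 < δ) (hψ : ContDiffOn ℝ 2 ψ (Icc 0 δ)) (hχ : ContDiffOn ℝ 2 χ (Icc 0 δ))
    {L₁ L₂ : ℂ} (hL₁ : Tendsto (fun t : ℝ => iteratedDeriv 2 (fun τ : ℝ => -2 * I * ψ τ) t) (𝓝[>] 0) (𝓝 L₁))
    (hL₂ : Tendsto (fun t : ℝ => 2 * I * ψ t + (12 * I * ψ t - 6 * I * χ t) / ((2 - 2 * Real.cos (3 * t) : ℝ) : ℂ)) (𝓝[>] 0) (𝓝 L₂)) :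
    (1 / 4 : ℂ) * (L₁ - L₂) =
        -(2 / 3) * I * iteratedDerivWithin 2 ψ (Icc 0 δ) 0 - (1 / 2) * I * ψ 0 + (1 / 12) * I * iteratedDerivWithin 2 χ (Icc 0 δ) 0 ∧
      12 * ψ 0 = 6 * χ 0 ∧ 12 * derivWithin ψ (Icc 0 δ) 0 = 6 * derivWithin χ (Icc 0 δ) 0 := by
  have hU : UniqueDiffOn ℝ (Icc 0 δ) := uniqueDiffOn_Icc hδ
  have h0 : (0 : ℝ) ∈ Icc 0 δ := left_mem_Icc.2 hδ.le
  have hψ0 : ContDiffWithinAt ℝ 2 ψ (Icc 0 δ) 0 := hψ 0 h0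
  have hχ0 : ContDiffWithinAt ℝ 2 χ (Icc 0 δ) 0 := hχ 0 h0
  -- `L₁ = −2i·ψ″(0⁺)`
  have hg : ContDiffOn ℝ 2 (fun τ : ℝ => -2 * I * ψ τ) (Icc 0 δ) := contDiffOn_const.mul hψ
  have hL₁' : L₁ = -2 * I * iteratedDerivWithin 2 ψ (Icc 0 δ) 0 := by
    have h := tendsto_nhds_unique hL₁ (tendsto_iteratedDeriv_two_nhdsGT hδ hg)
    rw [h, iteratedDerivWithin_const_mul h0 hU _ hψ0]
  -- `L₂ − 2i·ψ(0) = n″(0⁺)/18`, `n = 12iψ − 6iχ`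
  have hn : ContDiffOn ℝ 2 (fun t : ℝ => 12 * I * ψ t - 6 * I * χ t) (Icc 0 δ) := (contDiffOn_const.mul hψ).sub (contDiffOn_const.mul hχ)
  have hψc : Tendsto (fun t : ℝ => 2 * I * ψ t) (𝓝[>] 0) (𝓝 (2 * I * ψ 0)) :=
    (((contDiffOn_const.mul hψ).continuousOn.continuousWithinAt h0).tendsto).mono_left (nhdsGT_le_nhdsWithin_Icc hδ)
  have hLq : Tendsto (fun t : ℝ => (12 * I * ψ t - 6 * I * χ t) / ((2 - 2 * Real.cos (3 * t) : ℝ) : ℂ)) (𝓝[>] 0) (𝓝 (L₂ - 2 * I * ψ 0)) := by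
    have h := hL₂.sub hψc
    refine h.congr' ?_
    filter_upwards with t
    ring
  obtain ⟨hq0, hq1, hq2⟩ := eq_of_tendsto_div_wallNormaliser hδ hn hLq
  have hsplit : (fun t : ℝ => 12 * I * ψ t - 6 * I * χ t) = (fun t : ℝ => 12 * I * ψ t) - (fun t : ℝ => 6 * I * χ t) := rfl
  have hf12 : ContDiffWithinAt ℝ 2 (fun t : ℝ => 12 * I * ψ t) (Icc 0 δ) 0 := contDiffWithinAt_const.mul hψ0
  have hf6 : ContDiffWithinAt ℝ 2 (fun t : ℝ => 6 * I * χ t) (Icc 0 δ) 0 := contDiffWithinAt_const.mul hχ0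
  have hn2 : iteratedDerivWithin 2 (fun t : ℝ => 12 * I * ψ t - 6 * I * χ t) (Icc 0 δ) 0 =
      12 * I * iteratedDerivWithin 2 ψ (Icc 0 δ) 0 - 6 * I * iteratedDerivWithin 2 χ (Icc 0 δ) 0 := by
    rw [hsplit, iteratedDerivWithin_sub h0 hU hf12 hf6, iteratedDerivWithin_const_mul h0 hU _ hψ0,
      iteratedDerivWithin_const_mul h0 hU _ hχ0]
  have hn1 : derivWithin (fun t : ℝ => 12 * I * ψ t - 6 * I * χ t) (Icc 0 δ) 0 =
      12 * I * derivWithin ψ (Icc 0 δ) 0 - 6 * I * derivWithin χ (Icc 0 δ) 0 := by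
    rw [← iteratedDerivWithin_one, ← iteratedDerivWithin_one, ← iteratedDerivWithin_one, hsplit,
      iteratedDerivWithin_sub h0 hU (hf12.of_le (by norm_num)) (hf6.of_le (by norm_num)),
      iteratedDerivWithin_const_mul h0 hU _ (hψ0.of_le (by norm_num)), iteratedDerivWithin_const_mul h0 hU _ (hχ0.of_le (by norm_num))]
  refine ⟨?_, ?_, ?_⟩
  · rw [hL₁', show L₂ = (L₂ - 2 * I * ψ 0) + 2 * I * ψ 0 by ring, hq2, hn2]
    ring
  · have h := hq0
    have hI : (I : ℂ) ≠ 0 := Complex.I_ne_zero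
    have h' : I * (12 * ψ 0 - 6 * χ 0) = 0 := by linear_combination h
    have h'' := (mul_eq_zero.1 h').resolve_left hI
    linear_combination h''
  · rw [hn1] at hq1
    have hI : (I : ℂ) ≠ 0 := Complex.I_ne_zero
    have h' : I * (12 * derivWithin ψ (Icc 0 δ) 0 - 6 * derivWithin χ (Icc 0 δ) 0) = 0 := by linear_combination hq1
    have h'' := (mul_eq_zero.1 h').resolve_left hI
    linear_combination h''

end Value

end Literature.NumberTheory.Rogawski1990
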